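import Summits.HodgeConjecture.CorCM.Census.GroupFreeFaceBasis
import Summits.HodgeConjecture.CorCM.FaceCharacterSaturation
import HarnessLib

/-!
# The face-basis dictionary: abstract CM types of `(GalT F, conjT)` as place maps on a base type, and the linear transport
# `ℤ[types] ≃ ℤ^{Ty}` carrying `pairRel` onto `pairs` and corner indicators of faces onto face classes

COR-CM (cell `pub-hodgecm2`), count-neutral kernel combinatorics by the binder seat b09 (gen 27; lane GROUP-FREE-FACE-BASIS, André-3's
ask A6-R46), part IV: the DICTIONARY between the tree's intrinsic currency `ℤ[types of (GalT F, conjT)]` (`CMF (GalT F) conjT →₀ ℤ`,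
`pairRel`, `weightRel` of `CorCM/CM/LefschetzChar1.lean`; seat b23's reading `weightRel_corner_eq_read`,
`CorCM/FaceCharacterSaturation.lean`) and the group-free place model of `Census/OddSliceFacesModel.lean` /
`Census/GroupFreeFaceBasis.lean`.  Bookkeeping definitions (`tyOf`, `setOf`, `tyEquiv`, `rep`, `vecOf`) + theorems; no `decide`, no
certificate, no named fact, no `sorry`; `Interfaces.lean` (C1), every E term, B01, `Transposition/*` untouched.  HONEST FRAMING: `HC_CM`
is NOT proved, here or anywhere in the tree; nothing here is a period or a headline.  The sequel `CorCM/FaceBasisGeneratingSet.lean`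
turns the face basis into the generation binder `hgen` of INT2-GEN with no census.
T5 (coordinator ruling 2026-08-21T15:33:56Z (3)): n/a-class — no theorem of this file carries a Prop hypothesis binder other than the
instance `[IsGalois ℚ F]` and set-membership side conditions (`t ∈ T₀`, `t' ∉ orb conjT t`); no named fact, no conjecture-def, no
summit-side supply binder; checker: self (prover-pub-hodgecm2-b09-g27-0), 2026-08-22.

CONTENT.  Fix a base abstract CM type `T₀ : CMF (GalT F) conjT`.  Its members ARE a system of place representatives
(`T₀ ⊔ conjT·T₀ = GalT F`, `mem_or_conj_mem`, `two_mul_card`), so the place set is `Pl T₀ := ↥T₀` and an abstract CM type `Ψ` is the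
map `tyOf T₀ Ψ : Pl T₀ → ℤ/2`, `t ↦ [t ∉ Ψ]` — a BIJECTION (`tyEquiv`, inverse `setOf`); conjugation `barCM` is `+ 1` (`tyOf_barCM`),
the flip `oflipCM` at the place of `t` is `+ δ (rep T₀ t)` (`tyOf_oflipCM_rep`); translates at distinct places have distinct
representatives (`rep_ne_of_notMem_orb`).  §2: the induced `ℤ`-linear isomorphism `vecOf T₀` (`[Ψ] ↦ e_{tyOf Ψ}`, `vecOf_single`)
carries `pairRel` ONTO `pairs` (`map_pairRel_eq`) and the corner indicator `weightRel f.corner (fun _ ↦ {σ})` of ANY face read at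
ANY base embedding to the face class `faceVec (tyOf (pullType f.Φ σ)) (rep (translate σ f.p)) (rep (translate σ f.p'))` of
`Census/OddSliceFacesSquares.lean` (`vecOf_weightRel_corner`), hence into the Hodge lattice (`vecOf_weightRel_corner_mem_hodge`); the
face `faceOfG σ₀ Ψ t t'` manufactured from group data (`CorCM/CM/LefschetzChar2.lean`) reads `faceVec (tyOf Ψ) t t'`
(`vecOf_weightRel_faceOfG`).  §3: the BASIS FACES of `Census/GroupFreeFaceBasis.lean` as honest faces of `F` — `basisFace σ₀ T₀ hsel Q`
`= faceOfG σ₀ (tyEquiv⁻¹ 𝟙_Q) i_Q j_Q` for `Q ∈ BIdx (Pl T₀) i₀` and a two-place selector — read `bvec (Pl T₀) sel Q`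
(`vecOf_weightRel_basisFace`).  All [folklore]; the model is [cite: Pohlmann1968, Thm 1] read through
[cite: Milne1999LefschetzClasses, Thm. 3.2].

## References
* [Pohlmann1968] H. Pohlmann, Algebraic cycles on abelian varieties of complex multiplication type, Ann. of Math. 88 (1968), Thm 1.
* [Milne1999LefschetzClasses] J. S. Milne, Lefschetz classes on abelian varieties, Duke Math. J. 96 (1999), Thm. 3.2.
-/

noncomputable section

open NumberField NumberField.ComplexEmbedding
open scoped symmDiff

namespace Summit.HodgeConjecture.CorCM.FaceBasis

open Literature.AlgebraicGeometry.Motives (CMType)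
open Literature.NumberTheory.ComplexMultiplication.CMTypeOps
open Summit.HodgeConjecture.CorCM.Prior.AllgGroup.RfwfAllgGroup
open Summit.HodgeConjecture.CorCM.Census.OddSliceFacesModel (Ty hodge pairs pairVec δ delta_apply)
open Summit.HodgeConjecture.CorCM.Census.OddSliceFacesSquares (faceVec faceVec_mem)
open Summit.HodgeConjecture.CorCM.Census.GroupFreeFaceBasis (BIdx bvec)

variable {F : Type} [Field F] [NumberField F]

/-! ## §1 The place model on a base abstract CM type -/

/-- The place set attached to a base abstract CM type `T₀`: its members (one representative of each place `{t, conjT·t}`). [folklore] -/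
abbrev Pl (T₀ : CMF (GalT F) conjT) : Type := ↥T₀.1

/-- A member of `T₀` and its conjugate are not both in `T₀`. [folklore] -/
theorem conj_notMem (T₀ : CMF (GalT F) conjT) {x : GalT F} (hx : x ∈ T₀.1) : conjT * x ∉ T₀.1 :=
  (T₀.2 x).mp hx

/-- Every translate has its place represented in `T₀`: `x ∈ T₀` or `conjT·x ∈ T₀`. [folklore] -/
theorem mem_or_conj_mem (T₀ : CMF (GalT F) conjT) (x : GalT F) : x ∈ T₀.1 ∨ conjT * x ∈ T₀.1 := by
  by_cases hx : x ∈ T₀.1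
  · exact Or.inl hx
  · exact Or.inr (by_contra fun h => hx ((T₀.2 x).mpr h))

/-- `conjT · (conjT · x) = x`. [folklore] -/
theorem conj_conj (x : GalT F) : conjT * (conjT * x) = x := cmul_cmul conjT conjT_mul_self x

/-- The abstract CM type `Ψ` as a map on the places of `T₀`: `t ↦ 0` if `t ∈ Ψ`, `1` if `conjT·t ∈ Ψ`. [folklore] -/
def tyOf (T₀ Ψ : CMF (GalT F) conjT) : Ty (Pl T₀) := fun t => if (t : GalT F) ∈ Ψ.1 then 0 else 1

/-- Value of `tyOf` at a place: `0` iff the representative lies in `Ψ`. [folklore] -/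
theorem tyOf_eq_zero_iff (T₀ Ψ : CMF (GalT F) conjT) (t : Pl T₀) : tyOf T₀ Ψ t = 0 ↔ (t : GalT F) ∈ Ψ.1 := by
  unfold tyOf
  by_cases h : (t : GalT F) ∈ Ψ.1
  · simp [h]
  · simp [h]

/-- `tyOf` is injective. [folklore] -/
theorem tyOf_injective (T₀ : CMF (GalT F) conjT) : Function.Injective (tyOf T₀) := by
  intro Ψ Ψ' h
  apply Subtype.ext
  ext x
  rcases mem_or_conj_mem T₀ x with hx | hx
  · have e := congrFun h ⟨x, hx⟩
    rw [← tyOf_eq_zero_iff T₀ Ψ ⟨x, hx⟩, ← tyOf_eq_zero_iff T₀ Ψ' ⟨x, hx⟩, e]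
  · have e := congrFun h ⟨conjT * x, hx⟩
    have h1 : conjT * x ∈ Ψ.1 ↔ conjT * x ∈ Ψ'.1 := by
      rw [← tyOf_eq_zero_iff T₀ Ψ ⟨conjT * x, hx⟩, ← tyOf_eq_zero_iff T₀ Ψ' ⟨conjT * x, hx⟩, e]
    rw [Ψ.2 x, Ψ'.2 x, h1]

/-- The abstract CM type with prescribed place map `ψ` (inverse of `tyOf`), as a set of translates. [folklore] -/
def setOf (T₀ : CMF (GalT F) conjT) (ψ : Ty (Pl T₀)) : Finset (GalT F) :=
  Finset.univ.filter fun x => (∃ h : x ∈ T₀.1, ψ ⟨x, h⟩ = 0) ∨ (∃ h : conjT * x ∈ T₀.1, ψ ⟨conjT * x, h⟩ = 1)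

/-- Membership in `setOf` for a member of `T₀`. [folklore] -/
theorem mem_setOf_of_mem (T₀ : CMF (GalT F) conjT) (ψ : Ty (Pl T₀)) {x : GalT F} (hx : x ∈ T₀.1) :
    x ∈ setOf T₀ ψ ↔ ψ ⟨x, hx⟩ = 0 := by
  simp only [setOf, Finset.mem_filter, Finset.mem_univ, true_and]
  constructor
  · rintro (⟨_, h⟩ | ⟨h, _⟩)
    · exact h
    · exact absurd h (conj_notMem T₀ hx)
  · intro h; exact Or.inl ⟨hx, h⟩

/-- Membership in `setOf` for the conjugate of a member of `T₀`. [folklore] -/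
theorem conj_mem_setOf_of_mem (T₀ : CMF (GalT F) conjT) (ψ : Ty (Pl T₀)) {x : GalT F} (hx : x ∈ T₀.1) :
    conjT * x ∈ setOf T₀ ψ ↔ ψ ⟨x, hx⟩ = 1 := by
  simp only [setOf, Finset.mem_filter, Finset.mem_univ, true_and]
  constructor
  · rintro (⟨h, _⟩ | ⟨h', h⟩)
    · exact absurd h (conj_notMem T₀ hx)
    · have e : (⟨conjT * (conjT * x), h'⟩ : Pl T₀) = ⟨x, hx⟩ := Subtype.ext (conj_conj x)
      rwa [e] at h
  · intro h
    refine Or.inr ⟨by rw [conj_conj]; exact hx, ?_⟩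
    have e : (⟨conjT * (conjT * x), by rw [conj_conj]; exact hx⟩ : Pl T₀) = ⟨x, hx⟩ := Subtype.ext (conj_conj x)
    rw [e]; exact h

/-- `setOf ψ` is an abstract CM type. [folklore] -/
theorem isCMF_setOf (T₀ : CMF (GalT F) conjT) (ψ : Ty (Pl T₀)) : IsCMF conjT (setOf T₀ ψ) := by
  have h01 : ∀ u : ZMod 2, u = 0 ↔ ¬ u = 1 := by decide
  intro x
  rcases mem_or_conj_mem T₀ x with hx | hx
  · rw [mem_setOf_of_mem T₀ ψ hx, conj_mem_setOf_of_mem T₀ ψ hx]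
    exact h01 _
  · have e1 := conj_mem_setOf_of_mem T₀ ψ hx
    have e2 := mem_setOf_of_mem T₀ ψ hx
    rw [conj_conj] at e1
    rw [e1, e2]
    have h10 : ∀ u : ZMod 2, u = 1 ↔ ¬ u = 0 := by decide
    exact h10 _

/-- `tyOf` is surjective (`tyOf (setOf ψ) = ψ`). [folklore] -/
theorem tyOf_setOf (T₀ : CMF (GalT F) conjT) (ψ : Ty (Pl T₀)) : tyOf T₀ ⟨setOf T₀ ψ, isCMF_setOf T₀ ψ⟩ = ψ := by
  funext t
  have h01 : ∀ u : ZMod 2, ¬ u = 0 → u = 1 := by decide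
  by_cases h : ψ t = 0
  · rw [h, tyOf_eq_zero_iff]
    exact (mem_setOf_of_mem T₀ ψ t.2).mpr h
  · rw [h01 _ h]
    unfold tyOf
    rw [if_neg]
    exact fun hm => h ((mem_setOf_of_mem T₀ ψ t.2).mp hm)

/-- **The dictionary «abstract CM type ↔ place map»** is a bijection. [folklore] -/
def tyEquiv (T₀ : CMF (GalT F) conjT) : CMF (GalT F) conjT ≃ Ty (Pl T₀) where
  toFun := tyOf T₀
  invFun ψ := ⟨setOf T₀ ψ, isCMF_setOf T₀ ψ⟩
  left_inv Ψ := tyOf_injective T₀ (tyOf_setOf T₀ (tyOf T₀ Ψ))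
  right_inv ψ := tyOf_setOf T₀ ψ

/-- `tyEquiv` is `tyOf`. [folklore] -/
@[simp] theorem tyEquiv_apply (T₀ Ψ : CMF (GalT F) conjT) : tyEquiv T₀ Ψ = tyOf T₀ Ψ := rfl

/-- **Conjugation is `+ 1`.** [folklore] -/
theorem tyOf_barCM (T₀ Ψ : CMF (GalT F) conjT) : tyOf T₀ (barCM Ψ) = tyOf T₀ Ψ + 1 := by
  funext t
  simp only [tyOf, mem_barCM, Pi.add_apply, Pi.one_apply]
  by_cases h : (t : GalT F) ∈ Ψ.1
  · rw [if_neg (not_not.mpr h), if_pos h]; decide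
  · rw [if_pos h, if_neg h]; decide

/-- **The flip at the place of a member `t ∈ T₀` is `+ δ t`.** [folklore] -/
theorem tyOf_oflipCM (T₀ Ψ : CMF (GalT F) conjT) (t : Pl T₀) :
    tyOf T₀ (oflipCM conjT conjT_mul_self (t : GalT F) Ψ) = tyOf T₀ Ψ + δ (Pl T₀) t := by
  funext s
  have hsc : (s : GalT F) ≠ conjT * (t : GalT F) := fun h => conj_notMem T₀ t.2 (h ▸ s.2)
  have key : (s : GalT F) ∈ (oflipCM conjT conjT_mul_self (t : GalT F) Ψ).1 ↔ ¬ ((s : GalT F) ∈ Ψ.1 ↔ s = t) := by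
    change (s : GalT F) ∈ Ψ.1 ∆ orb conjT (t : GalT F) ↔ _
    rw [Finset.mem_symmDiff, mem_orb]
    have e : ((s : GalT F) = (t : GalT F)) ↔ s = t := Subtype.ext_iff.symm
    rw [e]
    tauto
  simp only [tyOf, Pi.add_apply, delta_apply]
  by_cases hst : s = t <;> by_cases h : (s : GalT F) ∈ Ψ.1
  · rw [if_neg (by rw [key]; tauto), if_pos h, if_pos hst]; decide
  · rw [if_pos (by rw [key]; tauto), if_neg h, if_pos hst]; decide
  · rw [if_pos (by rw [key]; tauto), if_pos h, if_neg hst]; decide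
  · rw [if_neg (by rw [key]; tauto), if_neg h, if_neg hst]; decide

/-- The representative in `T₀` of the place of `t`. [folklore] -/
def rep (T₀ : CMF (GalT F) conjT) (t : GalT F) : Pl T₀ :=
  if h : t ∈ T₀.1 then ⟨t, h⟩ else ⟨conjT * t, (mem_or_conj_mem T₀ t).resolve_left h⟩

/-- The representative lies in the place of `t`. [folklore] -/
theorem rep_mem_orb (T₀ : CMF (GalT F) conjT) (t : GalT F) : (rep T₀ t : GalT F) ∈ orb conjT t := by
  unfold rep
  by_cases h : t ∈ T₀.1
  · rw [dif_pos h, mem_orb]; exact Or.inl rfl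
  · rw [dif_neg h, mem_orb]; exact Or.inr rfl

/-- The representative of a member is itself. [folklore] -/
theorem rep_of_mem (T₀ : CMF (GalT F) conjT) {t : GalT F} (h : t ∈ T₀.1) : rep T₀ t = ⟨t, h⟩ := by
  unfold rep; rw [dif_pos h]

/-- Flipping at `t'` in the place of `t` is flipping at `t`. [folklore] -/
theorem oflipCM_eq_of_mem_orb {t t' : GalT F} (h : t' ∈ orb conjT t) (Ψ : CMF (GalT F) conjT) :
    oflipCM conjT conjT_mul_self t' Ψ = oflipCM conjT conjT_mul_self t Ψ := by
  apply Subtype.ext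
  change Ψ.1 ∆ orb conjT t' = Ψ.1 ∆ orb conjT t
  congr 1
  rcases (mem_orb conjT).mp h with rfl | rfl
  · rfl
  · ext x
    rw [mem_orb, mem_orb, conj_conj]
    tauto

/-- **The flip at the place of any `t` is `+ δ (rep t)`.** [folklore] -/
theorem tyOf_oflipCM_rep (T₀ Ψ : CMF (GalT F) conjT) (t : GalT F) :
    tyOf T₀ (oflipCM conjT conjT_mul_self t Ψ) = tyOf T₀ Ψ + δ (Pl T₀) (rep T₀ t) := by
  rw [← tyOf_oflipCM, oflipCM_eq_of_mem_orb (rep_mem_orb T₀ t)]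

/-- Translates at distinct places have distinct representatives. [folklore] -/
theorem rep_ne_of_notMem_orb (T₀ : CMF (GalT F) conjT) {t t' : GalT F} (h : t' ∉ orb conjT t) : rep T₀ t ≠ rep T₀ t' := by
  intro e
  have h1 := rep_mem_orb T₀ t
  have h2 := rep_mem_orb T₀ t'
  rw [e] at h1
  apply h
  rw [mem_orb] at h1 h2 ⊢
  rcases h1 with h1 | h1 <;> rcases h2 with h2 | h2
  · exact Or.inl (h2.symm.trans h1)
  · right
    have h3 : conjT * t' = t := h2.symm.trans h1
    calc t' = conjT * (conjT * t') := (conj_conj t').symm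
      _ = conjT * t := by rw [h3]
  · exact Or.inr (h2.symm.trans h1)
  · exact Or.inl (mul_left_cancel (h2.symm.trans h1))

/-- Distinct members of `T₀` lie at distinct places. [folklore] -/
theorem notMem_orb_of_ne (T₀ : CMF (GalT F) conjT) {t t' : Pl T₀} (h : t ≠ t') : (t' : GalT F) ∉ orb conjT (t : GalT F) := by
  intro hm
  rcases (mem_orb conjT).mp hm with e | e
  · exact h (Subtype.ext e.symm)
  · exact conj_notMem T₀ t.2 (e ▸ t'.2)

/-- `2 |T₀| = |GalT F|`: a CM type is half the group. [folklore] -/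
theorem two_mul_card (T₀ : CMF (GalT F) conjT) : 2 * Fintype.card (Pl T₀) = Fintype.card (GalT F) := by
  classical
  rw [Fintype.card_coe]
  have hdisj : Disjoint T₀.1 (T₀.1.image fun x => conjT * x) := by
    rw [Finset.disjoint_left]
    rintro x hx hx'
    obtain ⟨y, hy, rfl⟩ := Finset.mem_image.mp hx'
    exact conj_notMem T₀ hy hx
  have hunion : T₀.1 ∪ T₀.1.image (fun x => conjT * x) = Finset.univ := by
    ext x
    simp only [Finset.mem_union, Finset.mem_univ, iff_true]
    rcases mem_or_conj_mem T₀ x with hx | hx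
    · exact Or.inl hx
    · exact Or.inr (Finset.mem_image.mpr ⟨conjT * x, hx, conj_conj x⟩)
  have hinj : Set.InjOn (fun x : GalT F => conjT * x) T₀.1 := fun x _ y _ h => mul_left_cancel h
  have := Finset.card_union_of_disjoint hdisj
  rw [hunion, Finset.card_univ, Finset.card_image_of_injOn hinj] at this
  omega

/-! ## §2 The linear transport `ℤ[types] ≃ ℤ^{Ty (Pl T₀)}` -/

/-- The `ℤ`-linear isomorphism carrying `[Ψ]` to `e_{tyOf Ψ}`. [folklore] -/
def vecOf (T₀ : CMF (GalT F) conjT) : (CMF (GalT F) conjT →₀ ℤ) ≃ₗ[ℤ] (Ty (Pl T₀) → ℤ) :=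
  (Finsupp.linearEquivFunOnFinite ℤ ℤ (CMF (GalT F) conjT)).trans (LinearEquiv.funCongrLeft ℤ ℤ (tyEquiv T₀).symm)

/-- `vecOf [Ψ] = e_{tyOf Ψ}`. [folklore] -/
theorem vecOf_single (T₀ Ψ : CMF (GalT F) conjT) (c : ℤ) :
    vecOf T₀ (Finsupp.single Ψ c) = Pi.single (tyOf T₀ Ψ) c := by
  funext ψ
  simp only [vecOf, LinearEquiv.trans_apply, LinearEquiv.funCongrLeft_apply, LinearMap.funLeft_apply,
    Finsupp.linearEquivFunOnFinite_apply, Finsupp.single_apply, Pi.single_apply]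
  have hiff : Ψ = (tyEquiv T₀).symm ψ ↔ ψ = tyOf T₀ Ψ := by
    rw [Equiv.eq_symm_apply, tyEquiv_apply, eq_comm]
  simp only [hiff]

/-- A pair relation goes to a pair vector. [folklore] -/
theorem vecOf_pair (T₀ Ψ : CMF (GalT F) conjT) :
    vecOf T₀ (Finsupp.single Ψ 1 + Finsupp.single (barCM Ψ) 1) = pairVec (Pl T₀) (tyOf T₀ Ψ) := by
  rw [map_add, vecOf_single, vecOf_single, tyOf_barCM]
  rfl

/-- **`pairRel` goes onto `pairs`.** [folklore] -/
theorem map_pairRel_eq (T₀ : CMF (GalT F) conjT) :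
    (pairRel (F := F)).map (vecOf T₀ : (CMF (GalT F) conjT →₀ ℤ) →ₗ[ℤ] (Ty (Pl T₀) → ℤ)) = pairs (Pl T₀) := by
  apply le_antisymm
  · rw [Submodule.map_le_iff_le_comap]
    refine Submodule.span_le.mpr ?_
    rintro _ ⟨Ψ, rfl⟩
    rw [SetLike.mem_coe, Submodule.mem_comap, LinearEquiv.coe_coe, vecOf_pair]
    exact Submodule.subset_span ⟨_, rfl⟩
  · refine Submodule.span_le.mpr ?_
    rintro _ ⟨ψ, rfl⟩
    refine ⟨Finsupp.single ((tyEquiv T₀).symm ψ) 1 + Finsupp.single (barCM ((tyEquiv T₀).symm ψ)) 1,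
      Submodule.subset_span ⟨_, rfl⟩, ?_⟩
    rw [LinearEquiv.coe_coe, vecOf_pair, ← tyEquiv_apply, Equiv.apply_symm_apply]

/-- **The corner indicator of ANY face read at ANY base embedding goes to a face class** of `Census/OddSliceFacesSquares.lean`.
[folklore] -/
theorem vecOf_weightRel_corner [IsGalois ℚ F] (T₀ : CMF (GalT F) conjT) (f : Face F) (σ : F →+* ℂ) :
    vecOf T₀ (weightRel f.corner (fun _ => ({σ} : Finset (F →+* ℂ)))) =
      faceVec (Pl T₀) (tyOf T₀ (pullType f.Φ σ)) (rep T₀ (translate σ f.p)) (rep T₀ (translate σ f.p')) := by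
  rw [weightRel_corner_eq_read, map_add, map_add, map_add, vecOf_single, vecOf_single, vecOf_single, vecOf_single,
    tyOf_barCM, tyOf_barCM, tyOf_oflipCM_rep, tyOf_oflipCM_rep, tyOf_oflipCM_rep, tyOf_oflipCM_rep]
  unfold faceVec
  rw [add_right_comm (tyOf T₀ (pullType f.Φ σ)) (δ (Pl T₀) (rep T₀ (translate σ f.p))) 1,
    add_right_comm (tyOf T₀ (pullType f.Φ σ)) (δ (Pl T₀) (rep T₀ (translate σ f.p'))) 1]

/-- The corner indicator of a face is carried INTO THE HODGE LATTICE of the place model. [folklore] -/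
theorem vecOf_weightRel_corner_mem_hodge [IsGalois ℚ F] (T₀ : CMF (GalT F) conjT) (f : Face F) (σ : F →+* ℂ) :
    vecOf T₀ (weightRel f.corner (fun _ => ({σ} : Finset (F →+* ℂ)))) ∈ hodge (Pl T₀) := by
  rw [vecOf_weightRel_corner]
  exact faceVec_mem (Pl T₀) _ (rep_ne_of_notMem_orb T₀ (Face.translate_notMem_orb f σ))

/-- **The manufactured face `faceOfG σ₀ Ψ t t'` reads `faceVec (tyOf Ψ) t t'`** for members `t ≠ t'` of `T₀`. [folklore] -/
theorem vecOf_weightRel_faceOfG [IsGalois ℚ F] (T₀ : CMF (GalT F) conjT) (σ₀ : F →+* ℂ) (Ψ : CMF (GalT F) conjT)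
    (t t' : Pl T₀) (ht' : (t' : GalT F) ∉ orb conjT (t : GalT F)) :
    vecOf T₀ (weightRel (faceOfG σ₀ Ψ (t : GalT F) (t' : GalT F) ht').corner (fun _ => ({σ₀} : Finset (F →+* ℂ)))) =
      faceVec (Pl T₀) (tyOf T₀ Ψ) t t' := by
  rw [vecOf_weightRel_corner]
  change faceVec (Pl T₀) (tyOf T₀ (pullType (pushType σ₀ Ψ) σ₀)) (rep T₀ (translate σ₀ ((t : GalT F).1 σ₀)))
      (rep T₀ (translate σ₀ ((t' : GalT F).1 σ₀))) = _
  rw [pullType_pushType, translate_apply_eq, translate_apply_eq, rep_of_mem T₀ t.2, rep_of_mem T₀ t'.2]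

/-! ## §3 The basis faces `F(𝟙_Q; i_Q, j_Q)` as faces of `F` -/

/-- **The basis face** of `Q ∈ BIdx (Pl T₀) i₀` at the base embedding `σ₀` for the selector `sel`: the face of `F` with base type
`tyEquiv⁻¹ 𝟙_Q` (read at `σ₀`) and places those of the two selected members `i_Q ≠ j_Q` of `Q ⊆ T₀`. [folklore] -/
def basisFace [IsGalois ℚ F] (σ₀ : F →+* ℂ) (T₀ : CMF (GalT F) conjT) {sel : Finset (Pl T₀) → Pl T₀ × Pl T₀}
    (hsel : ∀ Q : Finset (Pl T₀), 1 < Q.card → (sel Q).1 ∈ Q ∧ (sel Q).2 ∈ Q ∧ (sel Q).1 ≠ (sel Q).2)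
    {i₀ : Pl T₀} (Q : BIdx (Pl T₀) i₀) : Face F :=
  faceOfG σ₀ ((tyEquiv T₀).symm (Census.OddSliceFacesModel.ind (Pl T₀) Q.1)) ((sel Q.1).1 : GalT F) ((sel Q.1).2 : GalT F)
    (notMem_orb_of_ne T₀ (hsel Q.1 Q.2.2).2.2)

/-- **The basis face reads the basis vector**: the corner indicator of `basisFace σ₀ T₀ hsel Q` at `σ₀` goes to `bvec (Pl T₀) sel Q`.
[folklore] -/
theorem vecOf_weightRel_basisFace [IsGalois ℚ F] (σ₀ : F →+* ℂ) (T₀ : CMF (GalT F) conjT)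
    {sel : Finset (Pl T₀) → Pl T₀ × Pl T₀}
    (hsel : ∀ Q : Finset (Pl T₀), 1 < Q.card → (sel Q).1 ∈ Q ∧ (sel Q).2 ∈ Q ∧ (sel Q).1 ≠ (sel Q).2)
    {i₀ : Pl T₀} (Q : BIdx (Pl T₀) i₀) :
    vecOf T₀ (weightRel (basisFace σ₀ T₀ hsel Q).corner (fun _ => ({σ₀} : Finset (F →+* ℂ)))) = bvec (Pl T₀) sel Q.1 := by
  unfold basisFace
  rw [vecOf_weightRel_faceOfG, ← tyEquiv_apply, Equiv.apply_symm_apply]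
  rfl

end Summit.HodgeConjecture.CorCM.FaceBasis

end
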